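import Literature.NumberTheory.LFunctions.FeketePolyaKernelCertificatesBlockWrappers
import HarnessLib

/-!
# No real zero for real primitive characters of conductor `12343 ≤ q ≤ 13362`: the Fekete–Pólya rows, in the kernel (rows deferred by the earlier engines)

Topic `Literature/NumberTheory/LFunctions`; namespace `Literature.NumberTheory.LFunctions`. THEOREMS only (no
definition, no named fact, no `sorry`; standard axioms): one PUBLIC theorem **`noRealZero{Odd,Even}_fp_<q>`** per
fundamental discriminant `D`, `|D| = q ∈ [12343, 13362]`, that admits a Fekete–Pólya witness but was DEFERRED by the per-position engines v1/v2 (walk too long for one `decide`) — for every primitive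
quadratic `χ` mod `q` of the parity of `D` and every `σ ∈ (0, 1)`, `L(σ, χ) ≠ 0` (statement shape of the
`interval_cases` bullets of the `NoRealZero{Odd,Even}…` range files, so a range assembly cites them by name).
Cell `parity-realchar`, kernel floor of the wide column (TARGET §2 row 19), Fekete–Pólya lane (seat prover-2).

Method (engine v4): `FeketePolyaKernelCertificatesBlock{,Wrappers}.lean` — the iterated partial sums of order
`K` of the induced character `χ↑(q·w)` are non-negative over one period, decided in the kernel BLOCKWISE on packed
base-`2^b` digits (`blockCert b B K (q·w) (tabs… b ps q w)`: sign tables of the character from the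
quadratic-residue bitsets of the prime factors of the conductor — the factor list is part of each certificate,
primality by `norm_num` — prefix sums by one big-integer multiplication per order and block, sign test by one
AND), hence `ℜL(σ, χ↑(q·w)) > 0` (Fekete–Pólya 1912 / MV §11.2.1 Exercise 7) and `L(σ, χ) ≠ 0` (positive Euler
factors, Exercise 8).  Witnesses `(w, K)` = the cheapest in the exact integer scan of this seat
(`HOME/parity-realchar-prover-2/fp-witnesses-*.tsv`; no kit); the digit width `b` is two bits above the size of
the running-sum bound recorded by the scan.  18 characters in this file (est. 77 kernel-s).
NOT covered here (no Fekete–Pólya witness with `w ≤ 40`, `q·w ≤ 4·10⁵`, `K ≤ 12`; the other Fekete–Pólya rows of this range are in the `NoRealZeroFeketePolyaX…` files) — left to the truncation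
certificates of the companion lane: see those files.

## References

* H. L. Montgomery, R. C. Vaughan, *Multiplicative Number Theory I*, CUP 2007, §9.3 Thm 9.13, §11.2.1
  Exercises 7–8. [MontgomeryVaughan2007]
* M. Fekete, G. Pólya, *Über ein Problem von Laguerre*, Rend. Circ. Mat. Palermo 34 (1912) 89–120. [FeketePolya1912]
-/

namespace Literature.NumberTheory.LFunctions

open FeketePolyaKernel

set_option maxHeartbeats 400000 in
/-- `D = -12343`: the odd character `(·/12343)` of conductor `12343` (`12343`: prime) — Fekete–Pólya witness of order `4` along the induced modulus `12343·15 = 185145`, block certificate (digits of `60` bits, splitting depth `9`); est. `3.2` kernel-s. [cite: MontgomeryVaughan2007, §11.2.1 Exercises 7 (g), 8] -/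
theorem noRealZeroOdd_fp_12343 :
    ∀ χ : DirichletCharacter ℂ 12343, χ.IsQuadratic → χ.IsPrimitive → χ.Odd →
      ∀ σ : ℝ, 0 < σ → σ < 1 → χ.LFunction σ ≠ 0 :=
  good_odd_of_odd_blk [12343] (by norm_num) (by decide) (by decide) 15 4 60 9 (by decide) (by decide) (by decide)
    (Or.inr (by decide +kernel))

set_option maxHeartbeats 400000 in
/-- `D = 12421`: the even character `(·/12421)` of conductor `12421` (`12421`: prime) — Fekete–Pólya witness of order `5` along the induced modulus `12421·7 = 86947`, block certificate (digits of `68` bits, splitting depth `9`); est. `2.8` kernel-s. [cite: MontgomeryVaughan2007, §11.2.1 Exercises 7 (g), 8] -/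
theorem noRealZeroEven_fp_12421 :
    ∀ χ : DirichletCharacter ℂ 12421, χ.IsQuadratic → χ.IsPrimitive → χ.Even →
      ∀ σ : ℝ, 0 < σ → σ < 1 → χ.LFunction σ ≠ 0 :=
  good_even_of_odd_blk [12421] (by norm_num) (by decide) (by decide) 7 5 68 9 (by decide) (by decide) (by decide)
    (Or.inr (by decide +kernel))

set_option maxHeartbeats 400000 in
/-- `D = -12452`: the odd character `χ₋₄·(·/3113)` of conductor `12452` (`3113`: 11 · 283) — Fekete–Pólya witness of order `4` along the induced modulus `12452·13 = 161876`, block certificate (digits of `58` bits, splitting depth `9`); est. `2.2` kernel-s. [cite: MontgomeryVaughan2007, §11.2.1 Exercises 7 (g), 8] -/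
theorem noRealZeroOdd_fp_12452 :
    ∀ χ : DirichletCharacter ℂ 12452, χ.IsQuadratic → χ.IsPrimitive → χ.Odd →
      ∀ σ : ℝ, 0 < σ → σ < 1 → χ.LFunction σ ≠ 0 :=
  good_odd_of_four_blk [11, 283] (by norm_num) (by decide) (by decide) 13 4 58 9 (by decide) (by decide) (by decide)
    (Or.inr (by decide +kernel))

set_option maxHeartbeats 400000 in
/-- `D = 12605`: the even character `(·/12605)` of conductor `12605` (`12605`: 5 · 2521) — Fekete–Pólya witness of order `6` along the induced modulus `12605·14 = 176470`, block certificate (digits of `87` bits, splitting depth `10`); est. `5.3` kernel-s. [cite: MontgomeryVaughan2007, §11.2.1 Exercises 7 (g), 8] -/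
theorem noRealZeroEven_fp_12605 :
    ∀ χ : DirichletCharacter ℂ 12605, χ.IsQuadratic → χ.IsPrimitive → χ.Even →
      ∀ σ : ℝ, 0 < σ → σ < 1 → χ.LFunction σ ≠ 0 :=
  good_even_of_odd_blk [5, 2521] (by norm_num) (by decide) (by decide) 14 6 87 10 (by decide) (by decide) (by decide)
    (Or.inr (by decide +kernel))

set_option maxHeartbeats 400000 in
/-- `D = -12739`: the odd character `(·/12739)` of conductor `12739` (`12739`: prime) — Fekete–Pólya witness of order `5` along the induced modulus `12739·22 = 280258`, block certificate (digits of `77` bits, splitting depth `11`); est. `7.5` kernel-s. [cite: MontgomeryVaughan2007, §11.2.1 Exercises 7 (g), 8] -/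
theorem noRealZeroOdd_fp_12739 :
    ∀ χ : DirichletCharacter ℂ 12739, χ.IsQuadratic → χ.IsPrimitive → χ.Odd →
      ∀ σ : ℝ, 0 < σ → σ < 1 → χ.LFunction σ ≠ 0 :=
  good_odd_of_odd_blk [12739] (by norm_num) (by decide) (by decide) 22 5 77 11 (by decide) (by decide) (by decide)
    (Or.inr (by decide +kernel))

set_option maxHeartbeats 400000 in
/-- `D = -12763`: the odd character `(·/12763)` of conductor `12763` (`12763`: prime) — Fekete–Pólya witness of order `6` along the induced modulus `12763·10 = 127630`, block certificate (digits of `86` bits, splitting depth `9`); est. `4.5` kernel-s. [cite: MontgomeryVaughan2007, §11.2.1 Exercises 7 (g), 8] -/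
theorem noRealZeroOdd_fp_12763 :
    ∀ χ : DirichletCharacter ℂ 12763, χ.IsQuadratic → χ.IsPrimitive → χ.Odd →
      ∀ σ : ℝ, 0 < σ → σ < 1 → χ.LFunction σ ≠ 0 :=
  good_odd_of_odd_blk [12763] (by norm_num) (by decide) (by decide) 10 6 86 9 (by decide) (by decide) (by decide)
    (Or.inr (by decide +kernel))

set_option maxHeartbeats 400000 in
/-- `D = 12764`: the even character `χ₋₄·(·/3191)` of conductor `12764` (`3191`: prime) — Fekete–Pólya witness of order `6` along the induced modulus `12764·21 = 268044`, block certificate (digits of `91` bits, splitting depth `11`); est. `8.1` kernel-s. [cite: MontgomeryVaughan2007, §11.2.1 Exercises 7 (g), 8] -/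
theorem noRealZeroEven_fp_12764 :
    ∀ χ : DirichletCharacter ℂ 12764, χ.IsQuadratic → χ.IsPrimitive → χ.Even →
      ∀ σ : ℝ, 0 < σ → σ < 1 → χ.LFunction σ ≠ 0 :=
  good_even_of_four_blk [3191] (by norm_num) (by decide) (by decide) 21 6 91 11 (by decide) (by decide) (by decide)
    (Or.inr (by decide +kernel))

set_option maxHeartbeats 400000 in
/-- `D = 12781`: the even character `(·/12781)` of conductor `12781` (`12781`: prime) — Fekete–Pólya witness of order `5` along the induced modulus `12781·7 = 89467`, block certificate (digits of `68` bits, splitting depth `9`); est. `2.9` kernel-s. [cite: MontgomeryVaughan2007, §11.2.1 Exercises 7 (g), 8] -/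
theorem noRealZeroEven_fp_12781 :
    ∀ χ : DirichletCharacter ℂ 12781, χ.IsQuadratic → χ.IsPrimitive → χ.Even →
      ∀ σ : ℝ, 0 < σ → σ < 1 → χ.LFunction σ ≠ 0 :=
  good_even_of_odd_blk [12781] (by norm_num) (by decide) (by decide) 7 5 68 9 (by decide) (by decide) (by decide)
    (Or.inr (by decide +kernel))

set_option maxHeartbeats 400000 in
/-- `D = 12828`: the even character `χ₋₄·(·/3207)` of conductor `12828` (`3207`: 3 · 1069) — Fekete–Pólya witness of order `6` along the induced modulus `12828·11 = 141108`, block certificate (digits of `86` bits, splitting depth `10`); est. `4.2` kernel-s. [cite: MontgomeryVaughan2007, §11.2.1 Exercises 7 (g), 8] -/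
theorem noRealZeroEven_fp_12828 :
    ∀ χ : DirichletCharacter ℂ 12828, χ.IsQuadratic → χ.IsPrimitive → χ.Even →
      ∀ σ : ℝ, 0 < σ → σ < 1 → χ.LFunction σ ≠ 0 :=
  good_even_of_four_blk [3, 1069] (by norm_num) (by decide) (by decide) 11 6 86 10 (by decide) (by decide) (by decide)
    (Or.inr (by decide +kernel))

set_option maxHeartbeats 400000 in
/-- `D = -12840`: the odd character `χ₋₈·(·/1605)` of conductor `12840` (`1605`: 3 · 5 · 107) — Fekete–Pólya witness of order `9` along the induced modulus `12840·7 = 89880`, block certificate (digits of `124` bits, splitting depth `9`); est. `4.6` kernel-s. [cite: MontgomeryVaughan2007, §11.2.1 Exercises 7 (g), 8] -/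
theorem noRealZeroOdd_fp_12840 :
    ∀ χ : DirichletCharacter ℂ 12840, χ.IsQuadratic → χ.IsPrimitive → χ.Odd →
      ∀ σ : ℝ, 0 < σ → σ < 1 → χ.LFunction σ ≠ 0 :=
  good_odd_of_eight_blk [3, 5, 107] (by norm_num) (by decide) (by decide) 7 9 124 9 (by decide) (by decide) (by decide)
    (Or.inr (by decide +kernel)) (Or.inl (by decide +kernel))

set_option maxHeartbeats 400000 in
/-- `D = 12877`: the even character `(·/12877)` of conductor `12877` (`12877`: 79 · 163) — Fekete–Pólya witness of order `5` along the induced modulus `12877·10 = 128770`, block certificate (digits of `71` bits, splitting depth `9`); est. `3.1` kernel-s. [cite: MontgomeryVaughan2007, §11.2.1 Exercises 7 (g), 8] -/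
theorem noRealZeroEven_fp_12877 :
    ∀ χ : DirichletCharacter ℂ 12877, χ.IsQuadratic → χ.IsPrimitive → χ.Even →
      ∀ σ : ℝ, 0 < σ → σ < 1 → χ.LFunction σ ≠ 0 :=
  good_even_of_odd_blk [79, 163] (by norm_num) (by decide) (by decide) 10 5 71 9 (by decide) (by decide) (by decide)
    (Or.inr (by decide +kernel))

set_option maxHeartbeats 400000 in
/-- `D = -12907`: the odd character `(·/12907)` of conductor `12907` (`12907`: prime) — Fekete–Pólya witness of order `8` along the induced modulus `12907·10 = 129070`, block certificate (digits of `114` bits, splitting depth `9`); est. `6.3` kernel-s. [cite: MontgomeryVaughan2007, §11.2.1 Exercises 7 (g), 8] -/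
theorem noRealZeroOdd_fp_12907 :
    ∀ χ : DirichletCharacter ℂ 12907, χ.IsQuadratic → χ.IsPrimitive → χ.Odd →
      ∀ σ : ℝ, 0 < σ → σ < 1 → χ.LFunction σ ≠ 0 :=
  good_odd_of_odd_blk [12907] (by norm_num) (by decide) (by decide) 10 8 114 9 (by decide) (by decide) (by decide)
    (Or.inr (by decide +kernel))

set_option maxHeartbeats 400000 in
/-- `D = 12917`: the even character `(·/12917)` of conductor `12917` (`12917`: prime) — Fekete–Pólya witness of order `4` along the induced modulus `12917·26 = 335842`, block certificate (digits of `59` bits, splitting depth `10`); est. `5.1` kernel-s. [cite: MontgomeryVaughan2007, §11.2.1 Exercises 7 (g), 8] -/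
theorem noRealZeroEven_fp_12917 :
    ∀ χ : DirichletCharacter ℂ 12917, χ.IsQuadratic → χ.IsPrimitive → χ.Even →
      ∀ σ : ℝ, 0 < σ → σ < 1 → χ.LFunction σ ≠ 0 :=
  good_even_of_odd_blk [12917] (by norm_num) (by decide) (by decide) 26 4 59 10 (by decide) (by decide) (by decide)
    (Or.inr (by decide +kernel))

set_option maxHeartbeats 400000 in
/-- `D = 13004`: the even character `χ₋₄·(·/3251)` of conductor `13004` (`3251`: prime) — Fekete–Pólya witness of order `4` along the induced modulus `13004·21 = 273084`, block certificate (digits of `59` bits, splitting depth `10`); est. `3.8` kernel-s. [cite: MontgomeryVaughan2007, §11.2.1 Exercises 7 (g), 8] -/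
theorem noRealZeroEven_fp_13004 :
    ∀ χ : DirichletCharacter ℂ 13004, χ.IsQuadratic → χ.IsPrimitive → χ.Even →
      ∀ σ : ℝ, 0 < σ → σ < 1 → χ.LFunction σ ≠ 0 :=
  good_even_of_four_blk [3251] (by norm_num) (by decide) (by decide) 21 4 59 10 (by decide) (by decide) (by decide)
    (Or.inr (by decide +kernel))

set_option maxHeartbeats 400000 in
/-- `D = -13127`: the odd character `(·/13127)` of conductor `13127` (`13127`: prime) — Fekete–Pólya witness of order `8` along the induced modulus `13127·7 = 91889`, block certificate (digits of `112` bits, splitting depth `9`); est. `4.7` kernel-s. [cite: MontgomeryVaughan2007, §11.2.1 Exercises 7 (g), 8] -/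
theorem noRealZeroOdd_fp_13127 :
    ∀ χ : DirichletCharacter ℂ 13127, χ.IsQuadratic → χ.IsPrimitive → χ.Odd →
      ∀ σ : ℝ, 0 < σ → σ < 1 → χ.LFunction σ ≠ 0 :=
  good_odd_of_odd_blk [13127] (by norm_num) (by decide) (by decide) 7 8 112 9 (by decide) (by decide) (by decide)
    (Or.inr (by decide +kernel))

set_option maxHeartbeats 400000 in
/-- `D = 13208`: the even character `χ₋₈·(·/1651)` of conductor `13208` (`1651`: 13 · 127) — Fekete–Pólya witness of order `3` along the induced modulus `13208·15 = 198120`, block certificate (digits of `41` bits, splitting depth `9`); est. `1.9` kernel-s. [cite: MontgomeryVaughan2007, §11.2.1 Exercises 7 (g), 8] -/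
theorem noRealZeroEven_fp_13208 :
    ∀ χ : DirichletCharacter ℂ 13208, χ.IsQuadratic → χ.IsPrimitive → χ.Even →
      ∀ σ : ℝ, 0 < σ → σ < 1 → χ.LFunction σ ≠ 0 :=
  good_even_of_eight_blk [13, 127] (by norm_num) (by decide) (by decide) 15 3 41 9 (by decide) (by decide) (by decide)
    (Or.inr (by decide +kernel)) (Or.inl (by decide +kernel))

set_option maxHeartbeats 400000 in
/-- `D = 13292`: the even character `χ₋₄·(·/3323)` of conductor `13292` (`3323`: prime) — Fekete–Pólya witness of order `4` along the induced modulus `13292·15 = 199380`, block certificate (digits of `57` bits, splitting depth `9`); est. `2.8` kernel-s. [cite: MontgomeryVaughan2007, §11.2.1 Exercises 7 (g), 8] -/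
theorem noRealZeroEven_fp_13292 :
    ∀ χ : DirichletCharacter ℂ 13292, χ.IsQuadratic → χ.IsPrimitive → χ.Even →
      ∀ σ : ℝ, 0 < σ → σ < 1 → χ.LFunction σ ≠ 0 :=
  good_even_of_four_blk [3323] (by norm_num) (by decide) (by decide) 15 4 57 9 (by decide) (by decide) (by decide)
    (Or.inr (by decide +kernel))

set_option maxHeartbeats 400000 in
/-- `D = -13339`: the odd character `(·/13339)` of conductor `13339` (`13339`: prime) — Fekete–Pólya witness of order `4` along the induced modulus `13339·21 = 280119`, block certificate (digits of `61` bits, splitting depth `10`); est. `4.5` kernel-s. [cite: MontgomeryVaughan2007, §11.2.1 Exercises 7 (g), 8] -/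
theorem noRealZeroOdd_fp_13339 :
    ∀ χ : DirichletCharacter ℂ 13339, χ.IsQuadratic → χ.IsPrimitive → χ.Odd →
      ∀ σ : ℝ, 0 < σ → σ < 1 → χ.LFunction σ ≠ 0 :=
  good_odd_of_odd_blk [13339] (by norm_num) (by decide) (by decide) 21 4 61 10 (by decide) (by decide) (by decide)
    (Or.inr (by decide +kernel))

end Literature.NumberTheory.LFunctions
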